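import Mathlib.Analysis.SpecialFunctions.Integrals.Basic
import Mathlib.Analysis.SpecialFunctions.Pow.Deriv
import Mathlib.Analysis.SpecialFunctions.Log.NegMulLog
import HarnessLib

/-!
# The far-field indicial integrals of the linearised hard-sphere operator (the resonance table)
# (helpers `t12_indicial_ell0`, `t12_indicial_logResonance` of the line `birth`, crux `TwoClocks.EquilibriumFastWindowLD`,
# stmt-AtomisticToContinuum-14440; first inputs of the registered sub-goal `t12_logLinearPreimage_and_dipoleModulus`)

The corrector transfer of the line `birth` inverts the linearised hard-sphere operator `L = -ν + K` of `ℝ³`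
(`M`-weighted picture, CIP 1994 §7.2) on data of quadratic growth, and the growth of the pre-image is decided
at LARGE SPEED `s = |v| → ∞` ("Lorentz limit": the Maxwellian partner `w` is at rest to relative accuracy
`O(1/s)`). There a collision with impact direction `ω`, `c := v̂·ω ∈ [0, 1]` (flux law: `c²` uniform, i.e.
density `2c dc`), produces the scattered tagged velocity `v' = v - (v·ω)ω` and the recoiling field velocity
`w' = (v·ω)ω`; both lie on the Thales sphere `{u : |u|² = u·v}`, with radius ratio `|u|/s` EQUAL to the
direction cosine `û·v̂`, namely `√(1 - c²)` for `v'` and `c` for `w'`. Hence on a separable profile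
`u = |v|^α Y_ℓ(v̂)` the gain term acts as `ν⁻¹ K₂^∞ u = λ_ℓ(α) u` with the INDICIAL MULTIPLIER

  `λ_ℓ(α) = ∫₀¹ 2c [(1 - c²)^{α/2} P_ℓ(√(1 - c²)) + c^α P_ℓ(c)] dc = 4 ∫₀¹ ρ^{α+1} P_ℓ(ρ) dρ`

(the two pieces are equal: substitute `c ↦ √(1 - c²)`, `integral_two_mul_mul_comp_sqrt_one_sub_sq`), and the
far-field homogeneous solutions of `L ψ = 0` in the sector `ℓ` are the `|v|^α Y_ℓ` with `λ_ℓ(α) = 1`. This file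
proves the closed forms that pin this "resonance table" (derived and checked numerically in the crux note
`Summits/AtomisticToContinuum/HydrodynamicLimit/Cruxes/EquilibriumFastWindowLD/CorrectorLogResonance.md`):

* `t12_indicial_ell0` (registered helper) — **`λ₀(α) = 4/(α+2)`** (`-1 < α`); indicial root `α = 2`: the
  energy invariant `|v|²` (and `λ₀(α) < 1 ⇔ α > 2`: why no positive supersolution exists below the energy
  weight);
* `t12_indicial_ell1`, `t12_indicial_ell1'` — **`λ₁(α) = 4/(α+3)`**; indicial root `α = 1`: the momentum
  invariant `v`, i.e. THE `ℓ = 1` LOG-RESONANCE of the corrector (quadratic dipole data `g ∝ |v|² Y₁`, i.e.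
  `ν⁻¹ g ∝ |v| Y₁`, sit exactly on the root: no power-law pre-image, the pre-image grows like `|v| log|v| · Y₁`);
  also `λ₂(2) = 1/2` from `t12_indicial_ell2` (the Burnett profile `v_i v_j - δ_ij |v|²/3` has a quadratic pre-image);
* `t12_indicial_logResonance` (registered helper) — the resonance constant
  **`κ := λ₁'(1) = ∫₀¹ 2c [(1 - c²) · ½ log(1 - c²) + c² log c] dc = -1/4`** (`= d/dα` of the `ℓ = 1`
  two-piece integrand at `α = 1`), the coefficient of the logarithm: `L(v_z log|v|)/|v|² → -π/4 · (v̂)_z`;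
* `t12_indicial_ell2`, `t12_indicial_ell2_lt_one`, `t12_indicial_ell2_one`, `t12_indicial_ell3_one`,
  `t12_indicial_ell4_one` — **`λ₂(α) = (4α+4)/((α+2)(α+4)) < 1`** (no indicial root in the quadrupole sector)
  and the `α = 1` column `λ₂(1) = 8/15`, `λ₃(1) = 1/6`, `λ₄(1) = 0` of the table
  `λ_ℓ(1) = 4/3, 1, 8/15, 1/6, 0, -1/48, 0, …` (`sup_{ℓ ≥ 2} |λ_ℓ(1)| = 8/15 < 1`: no resonance for `ℓ ≥ 2`);
* the pieces `integral_two_mul_mul_one_sub_sq_rpow` (tangential, `= 2/(α+2)`, improper range `-2 < α < 0`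
  included via a continuous antiderivative and `intervalIntegral.integrableOn_deriv_of_nonneg`) and
  `integral_two_mul_mul_rpow` (radial, `= 2/(α+2)`), and the Thales symmetry
  `integral_two_mul_mul_comp_sqrt_one_sub_sq` : `∫₀¹ 2c g(√(1 - c²)) dc = ∫₀¹ 2ρ g(ρ) dρ`.

Pure real analysis (Mathlib only): `integral_rpow`, FTC-2 (`integral_eq_sub_of_hasDerivAt_of_le`), the
substitution rule `integral_comp_mul_deriv'`, continuity of `x log x` (`Real.continuous_mul_log`). NOT here:
the far-field representation of `K₂` itself (the future file "…FarFieldIterates" of the T1/T2 plan), the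
Legendre bound for `ℓ ≥ 5`, and anything about the hard-sphere dynamics. All identities are [folklore]
(Grad 1963 §4; Cercignani–Illner–Pulvirenti 1994 §7.2 for `ν`, `K`).
-/

noncomputable section

open MeasureTheory Real Set intervalIntegral
open scoped ENNReal BigOperators

namespace Summit.AtomisticToContinuum.HydrodynamicLimit.Theorems.ClampedCorrectorBirth

/-! ### Calculus helpers -/

/-- FTC on `[0, 1]` for an antiderivative `F` continuous on `[0, 1]` whose derivative `f` on `(0, 1)` is
nonnegative: then `f` is automatically integrable (`intervalIntegral.integrableOn_deriv_of_nonneg`) and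
`∫₀¹ f = F 1 - F 0`. This is how the improper cases (`rpow` with exponent in `(-1, 0)`) are handled. [folklore] -/
theorem integral_unitInterval_eq_sub_of_hasDerivAt_of_nonneg {F f : ℝ → ℝ} (hcont : ContinuousOn F (Icc 0 1))
    (hderiv : ∀ x ∈ Ioo (0:ℝ) 1, HasDerivAt F (f x) x) (hpos : ∀ x ∈ Ioo (0:ℝ) 1, 0 ≤ f x) :
    IntervalIntegrable f volume 0 1 ∧ ∫ x in (0:ℝ)..1, f x = F 1 - F 0 := by
  have hint : IntervalIntegrable f volume 0 1 :=
    (intervalIntegrable_iff_integrableOn_Ioc_of_le zero_le_one).2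
      (integrableOn_deriv_of_nonneg hcont hderiv hpos)
  exact ⟨hint, integral_eq_sub_of_hasDerivAt_of_le zero_le_one hcont hderiv hint⟩

/-- The derivative of `y ↦ 1 - y²` is `-2y`. [folklore] -/
theorem hasDerivAt_one_sub_sq (x : ℝ) : HasDerivAt (fun y : ℝ => 1 - y ^ 2) (-(2 * x)) x := by
  simpa using (hasDerivAt_pow 2 x).const_sub 1

/-- **Thales symmetry of the far-field collision step.** For `g` continuous on `[0, 1]`:
`∫₀¹ 2c · g(√(1 - c²)) dc = ∫₀¹ 2ρ · g(ρ) dρ` (both equal `∫₀¹ g(√u) du`: substitute `u = 1 - c²`,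
resp. `u = ρ²`). Kinetic meaning: under the flux law `2c dc` of the impact cosine `c = v̂·ω`, the radius
ratio `√(1 - c²)` of the scattered tagged particle and the radius ratio `c` of the recoiling field particle
have the SAME law `2ρ dρ`; hence the two pieces of every indicial multiplier `λ_ℓ(α)` coincide and
`λ_ℓ(α) = 4 ∫₀¹ ρ^{α+1} P_ℓ(ρ) dρ`. [folklore] -/
theorem integral_two_mul_mul_comp_sqrt_one_sub_sq {g : ℝ → ℝ} (hg : ContinuousOn g (Icc 0 1)) :
    ∫ c in (0:ℝ)..1, 2 * c * g (Real.sqrt (1 - c ^ 2)) = ∫ ρ in (0:ℝ)..1, 2 * ρ * g ρ := by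
  have hgs : ContinuousOn (fun u : ℝ => g (Real.sqrt u)) (Icc 0 1) := by
    refine hg.comp continuous_sqrt.continuousOn fun u hu => ⟨sqrt_nonneg u, ?_⟩
    rw [sqrt_le_one]
    exact hu.2
  -- left-hand side: `u = 1 - c²`
  have hL : ∫ c in (0:ℝ)..1, 2 * c * g (Real.sqrt (1 - c ^ 2)) = ∫ u in (0:ℝ)..1, g (Real.sqrt u) := by
    have himg : (fun c : ℝ => 1 - c ^ 2) '' uIcc 0 1 ⊆ Icc 0 1 := by
      rintro _ ⟨c, hc, rfl⟩
      rw [uIcc_of_le zero_le_one] at hc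
      exact ⟨by nlinarith [hc.1, hc.2], by nlinarith [hc.1, hc.2]⟩
    have key := integral_comp_mul_deriv' (a := 0) (b := 1) (g := fun u : ℝ => g (Real.sqrt u))
      (fun c _ => hasDerivAt_one_sub_sq c) (by fun_prop) (hgs.mono himg)
    simp only [Function.comp_def] at key
    rw [show (1:ℝ) - 0 ^ 2 = 1 by norm_num, show (1:ℝ) - 1 ^ 2 = 0 by norm_num, integral_symm (0:ℝ) 1] at key
    calc ∫ c in (0:ℝ)..1, 2 * c * g (Real.sqrt (1 - c ^ 2))
        = -∫ c in (0:ℝ)..1, g (Real.sqrt (1 - c ^ 2)) * -(2 * c) := by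
          rw [← intervalIntegral.integral_neg]
          exact integral_congr fun c _ => by ring
      _ = ∫ u in (0:ℝ)..1, g (Real.sqrt u) := by rw [key, neg_neg]
  -- right-hand side: `u = ρ²`
  have hR : ∫ ρ in (0:ℝ)..1, 2 * ρ * g ρ = ∫ u in (0:ℝ)..1, g (Real.sqrt u) := by
    have himg : (fun ρ : ℝ => ρ ^ 2) '' uIcc 0 1 ⊆ Icc 0 1 := by
      rintro _ ⟨ρ, hρ, rfl⟩
      rw [uIcc_of_le zero_le_one] at hρ
      exact ⟨by positivity, by nlinarith [hρ.1, hρ.2]⟩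
    have hd : ∀ ρ ∈ uIcc (0:ℝ) 1, HasDerivAt (fun ρ : ℝ => ρ ^ 2) (2 * ρ) ρ := fun ρ _ => by
      simpa using hasDerivAt_pow 2 ρ
    have key := integral_comp_mul_deriv' hd (by fun_prop) (hgs.mono himg)
    simp only [Function.comp_def] at key
    rw [show (0:ℝ) ^ 2 = 0 by norm_num, show (1:ℝ) ^ 2 = 1 by norm_num] at key
    rw [← key]
    refine integral_congr fun ρ hρ => ?_
    rw [uIcc_of_le zero_le_one] at hρ
    simp only [sqrt_sq hρ.1]
    ring
  exact hL.trans hR.symm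

/-! ### The two pieces of `λ₀(α)` -/

/-- **Tangential piece of `λ₀`.** For `-2 < α`:  `∫₀¹ 2x (1 - x²)^{α/2} dx = 2/(α+2)`, with integrability
(substitution `u = 1 - x²`, done through the antiderivative `-(2/(α+2)) (1 - x²)^{(α+2)/2}`, continuous on
`[0, 1]`, so the improper range `-2 < α < 0` is covered). In the far-field calculus this is the contribution
of the scattered tagged velocity `v' = v - (v·ω)ω` (radius ratio `√(1 - c²)`) acting on `|v|^α`. [folklore] -/
theorem integral_two_mul_mul_one_sub_sq_rpow {α : ℝ} (hα : -2 < α) :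
    IntervalIntegrable (fun x : ℝ => 2 * x * (1 - x ^ 2) ^ (α / 2)) volume 0 1 ∧
      ∫ x in (0:ℝ)..1, 2 * x * (1 - x ^ 2) ^ (α / 2) = 2 / (α + 2) := by
  have hβ : 0 < (α + 2) / 2 := by linarith
  have hcont : Continuous fun y : ℝ => -(2 / (α + 2)) * (1 - y ^ 2) ^ ((α + 2) / 2) :=
    continuous_const.mul ((continuous_const.sub (continuous_pow 2)).rpow_const fun _ => Or.inr hβ.le)
  have hderiv : ∀ x ∈ Ioo (0:ℝ) 1, HasDerivAt (fun y : ℝ => -(2 / (α + 2)) * (1 - y ^ 2) ^ ((α + 2) / 2))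
      (2 * x * (1 - x ^ 2) ^ (α / 2)) x := by
    intro x hx
    have hx1 : 1 - x ^ 2 ≠ 0 := (by nlinarith [hx.1, hx.2] : (0:ℝ) < 1 - x ^ 2).ne'
    refine (((hasDerivAt_one_sub_sq x).rpow_const (p := (α + 2) / 2) (Or.inl hx1)).const_mul
      (-(2 / (α + 2)))).congr_deriv ?_
    rw [show (α + 2) / 2 - 1 = α / 2 by ring]
    have hα' : α + 2 ≠ 0 := by linarith
    field_simp
  have hpos : ∀ x ∈ Ioo (0:ℝ) 1, 0 ≤ 2 * x * (1 - x ^ 2) ^ (α / 2) := fun x hx =>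
    mul_nonneg (by linarith [hx.1]) (rpow_nonneg (by nlinarith [hx.1, hx.2] : (0:ℝ) < 1 - x ^ 2).le _)
  obtain ⟨hint, hval⟩ := integral_unitInterval_eq_sub_of_hasDerivAt_of_nonneg hcont.continuousOn hderiv hpos
  refine ⟨hint, ?_⟩
  rw [hval]
  simp [zero_rpow hβ.ne']

/-- **Radial piece of `λ₀`.** For `-1 < α`:  `∫₀¹ 2x · x^α dx = 2/(α+2)`, with integrability
(`integral_rpow`). In the far-field calculus this is the contribution of the recoiling field particle
`w' = (v·ω)ω` (radius ratio `c = v̂·ω`) acting on `|v|^α`; it EQUALS the tangential piece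
(`integral_two_mul_mul_one_sub_sq_rpow`, an instance of `integral_two_mul_mul_comp_sqrt_one_sub_sq`). [folklore] -/
theorem integral_two_mul_mul_rpow {α : ℝ} (hα : -1 < α) :
    IntervalIntegrable (fun x : ℝ => 2 * x * x ^ α) volume 0 1 ∧
      ∫ x in (0:ℝ)..1, 2 * x * x ^ α = 2 / (α + 2) := by
  have heq : EqOn (fun x : ℝ => 2 * x * x ^ α) (fun x : ℝ => 2 * x ^ (α + 1)) (uIcc 0 1) := by
    intro x hx
    rw [uIcc_of_le zero_le_one] at hx
    change 2 * x * x ^ α = 2 * x ^ (α + 1)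
    rw [rpow_add_one' hx.1 (by linarith), mul_assoc, mul_comm x]
  have hint' : IntervalIntegrable (fun x : ℝ => 2 * x ^ (α + 1)) volume 0 1 :=
    (intervalIntegral.intervalIntegrable_rpow' (by linarith)).const_mul 2
  refine ⟨?_, ?_⟩
  · rw [intervalIntegrable_iff_integrableOn_Icc_of_le zero_le_one] at hint' ⊢
    exact hint'.congr_fun (fun x hx => (heq (by rwa [uIcc_of_le zero_le_one])).symm) measurableSet_Icc
  · rw [integral_congr heq, intervalIntegral.integral_const_mul, integral_rpow (Or.inl (by linarith)),
      zero_rpow (by linarith : (0:ℝ) < α + 1 + 1).ne', one_rpow]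
    have hα' : α + 2 ≠ 0 := by linarith
    have hα'' : α + 1 + 1 ≠ 0 := by linarith
    field_simp
    ring

/-! ### `ℓ = 0` and `ℓ = 1`: the two resonant sectors -/

/-- **`λ₀(α) = 4/(α+2)` — the monopole (`ℓ = 0`) far-field multiplier of the linearised hard-sphere
operator of `ℝ³`.** For `-1 < α`:  `∫₀¹ 2x ((1 - x²)^{α/2} + x^α) dx = 4/(α+2)` (real powers). The
indicial equation `λ₀(α) = 1` has the single root `α = 2` — the energy invariant `|v|²`; `λ₀(0) = 2` is the
mass of the far-field step (`K₂ 1 = 2ν` to leading order), and `λ₀(α) < 1 ⇔ α > 2` is the obstruction to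
positive supersolutions below the energy weight recorded in the T1/T2 plan. Registered helper of the line
`birth` (crux note `CorrectorLogResonance.md`). [folklore] -/
theorem t12_indicial_ell0 : ∀ α : ℝ, -1 < α → ∫ x in (0:ℝ)..1, 2 * x * ((1 - x ^ 2) ^ (α / 2) + x ^ α) = 4 / (α + 2) := by
  intro α hα
  obtain ⟨hBi, hB⟩ := integral_two_mul_mul_one_sub_sq_rpow (α := α) (by linarith)
  obtain ⟨hAi, hA⟩ := integral_two_mul_mul_rpow hα
  have : ∫ x in (0:ℝ)..1, 2 * x * ((1 - x ^ 2) ^ (α / 2) + x ^ α) =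
      ∫ x in (0:ℝ)..1, (2 * x * (1 - x ^ 2) ^ (α / 2) + 2 * x * x ^ α) :=
    integral_congr fun x _ => by ring
  rw [this, integral_add hBi hAi, hB, hA]
  ring

/-- **`λ₁(α) = 4/(α+3)` — the dipole (`ℓ = 1`) far-field multiplier**, in the form
`∫₀¹ 2x ((1 - x²)^{(α+1)/2} + x^{α+1}) dx = 4/(α+3)` (`-1 < α`): inserting `P₁(ρ) = ρ` multiplies the
tangential piece by `√(1 - x²)` and the radial piece by `x`, i.e. shifts `α ↦ α + 1` in `λ₀`. The indicial
equation `λ₁(α) = 1` has the single root `α = 1` — the momentum invariant `v = |v| Y₁(v̂)`: data of linear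
growth in the dipole sector sit EXACTLY on the root, which is the `ℓ = 1` log-resonance of the corrector
(`CorrectorLogResonance.md`; the pre-image of `|v| Y₁`-type data grows like `|v| log|v|`). [folklore] -/
theorem t12_indicial_ell1 : ∀ α : ℝ, -1 < α →
    ∫ x in (0:ℝ)..1, 2 * x * ((1 - x ^ 2) ^ ((α + 1) / 2) + x ^ (α + 1)) = 4 / (α + 3) := by
  intro α hα
  rw [t12_indicial_ell0 (α + 1) (by linarith)]
  ring

/-- `λ₁(α) = 4/(α+3)` with the Legendre factors written out (`P₁(√(1 - x²)) = √(1 - x²)` on the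
tangential piece, `P₁(x) = x` on the radial piece): for `-1 < α`,
`∫₀¹ 2x ((1 - x²)^{α/2} √(1 - x²) + x^α x) dx = 4/(α+3)`. [folklore] -/
theorem t12_indicial_ell1' : ∀ α : ℝ, -1 < α →
    ∫ x in (0:ℝ)..1, 2 * x * ((1 - x ^ 2) ^ (α / 2) * Real.sqrt (1 - x ^ 2) + x ^ α * x) = 4 / (α + 3) := by
  intro α hα
  rw [← t12_indicial_ell1 α hα]
  refine integral_congr fun x hx => ?_
  rw [uIcc_of_le zero_le_one] at hx
  have h1 : 0 ≤ 1 - x ^ 2 := by nlinarith [hx.1, hx.2]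
  rw [sqrt_eq_rpow, ← rpow_add' h1 (by linarith), ← rpow_add_one' hx.1 (by linarith)]
  congr 2
  ring

/-- **The log-resonance constant `κ = λ₁'(1) = -1/4`.** Differentiating the two-piece integrand of `λ₁`
at the root `α = 1` (`d/dα (1 - x²)^{(α+1)/2} = (1 - x²)^{(α+1)/2} · ½ log(1 - x²)`,
`d/dα x^{α+1} = x^{α+1} log x`) gives
`κ := ∫₀¹ 2x [(1 - x²) · ½ log(1 - x²) + x² log x] dx = -1/8 - 1/8 = -1/4` (`= d/dα (4/(α+3))` at `α = 1`).
Since `κ ≠ 0` the root `α = 1` of `λ₁` is SIMPLE: with `ν ~ π|v|`, `ν⁻¹ L (|v| log|v| Y₁) ~ κ |v| Y₁` while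
`ν⁻¹ L (|v| Y₁) ~ (λ₁(1) - 1)|v| Y₁ = 0` (momentum invariant), so dipole data `g ~ c |v|² Y₁(v̂)` of quadratic
growth have the far-field pre-image `ψ ~ (c/(π κ)) |v| log|v| Y₁ = -(4c/π) |v| log|v| Y₁` — the log-linear
class of T1 and the log-modulus of T2 (`L(v_z log|v|)/|v|² → π κ (v̂)_z = -(π/4)(v̂)_z`, checked numerically by
the lead, kit job j022405).
Proof: the antiderivative `x⁴ log x / 2 - x⁴/8 - (1 - x²)² log(1 - x²)/4 + (1 - x²)²/8` is continuous on
`[0, 1]` (`x log x → 0`) and the integrand is continuous, so plain FTC applies. Registered helper of the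
line `birth`. [folklore] -/
theorem t12_indicial_logResonance : ∫ x in (0:ℝ)..1, 2 * x * ((1 - x ^ 2) * (Real.log (1 - x ^ 2) / 2) + x ^ 2 * Real.log x) = -1 / 4 := by
  have hFc : Continuous fun y : ℝ => y ^ 3 * (y * Real.log y) / 2 - y ^ 4 / 8
      - (1 - y ^ 2) * ((1 - y ^ 2) * Real.log (1 - y ^ 2)) / 4 + (1 - y ^ 2) ^ 2 / 8 := by
    fun_prop
  have hFc' : Continuous fun y : ℝ => y ^ 4 * Real.log y / 2 - y ^ 4 / 8
      - (1 - y ^ 2) ^ 2 * Real.log (1 - y ^ 2) / 4 + (1 - y ^ 2) ^ 2 / 8 := by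
    convert hFc using 1
    funext y
    ring
  have hfc : Continuous fun x : ℝ =>
      x * ((1 - x ^ 2) * Real.log (1 - x ^ 2)) + 2 * x ^ 2 * (x * Real.log x) := by
    fun_prop
  have hfc' : Continuous fun x : ℝ =>
      2 * x * ((1 - x ^ 2) * (Real.log (1 - x ^ 2) / 2) + x ^ 2 * Real.log x) := by
    convert hfc using 1
    funext x
    ring
  have hderiv : ∀ x ∈ Ioo (0:ℝ) 1, HasDerivAt (fun y : ℝ => y ^ 4 * Real.log y / 2 - y ^ 4 / 8
      - (1 - y ^ 2) ^ 2 * Real.log (1 - y ^ 2) / 4 + (1 - y ^ 2) ^ 2 / 8)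
      (2 * x * ((1 - x ^ 2) * (Real.log (1 - x ^ 2) / 2) + x ^ 2 * Real.log x)) x := by
    intro x hx
    have hx0 : x ≠ 0 := hx.1.ne'
    have hx1 : 1 - x ^ 2 ≠ 0 := (by nlinarith [hx.1, hx.2] : (0:ℝ) < 1 - x ^ 2).ne'
    have hp4 : HasDerivAt (fun y : ℝ => y ^ 4) (4 * x ^ 3) x := by simpa using hasDerivAt_pow 4 x
    have hl : HasDerivAt (fun y : ℝ => Real.log y) x⁻¹ x := hasDerivAt_log hx0
    have hg := hasDerivAt_one_sub_sq x
    have hg2 : HasDerivAt (fun y : ℝ => (1 - y ^ 2) ^ 2) (2 * (1 - x ^ 2) * (-(2 * x))) x := by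
      simpa using hg.fun_pow 2
    have hlg : HasDerivAt (fun y : ℝ => Real.log (1 - y ^ 2)) (-(2 * x) / (1 - x ^ 2)) x := hg.log hx1
    refine ((((hp4.mul hl).div_const 2).sub (hp4.div_const 8)).sub ((hg2.mul hlg).div_const 4) |>.add
      (hg2.div_const 8)).congr_deriv ?_
    field_simp
    ring
  rw [integral_eq_sub_of_hasDerivAt_of_le zero_le_one hFc'.continuousOn hderiv (hfc'.intervalIntegrable 0 1)]
  norm_num

/-! ### `ℓ ≥ 2`: no resonance -/

/-- **`λ₂(α) = (4α+4)/((α+2)(α+4))` — the quadrupole (`ℓ = 2`) far-field multiplier** in the radial form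
`λ₂(α) = 4 ∫₀¹ ρ^{α+1} P₂(ρ) dρ`, `P₂(ρ) = (3ρ² - 1)/2`, for `-1 < α`. [folklore] -/
theorem t12_indicial_ell2 : ∀ α : ℝ, -1 < α →
    ∫ x in (0:ℝ)..1, 4 * x ^ (α + 1) * ((3 * x ^ 2 - 1) / 2) = (4 * α + 4) / ((α + 2) * (α + 4)) := by
  intro α hα
  have heq : EqOn (fun x : ℝ => 4 * x ^ (α + 1) * ((3 * x ^ 2 - 1) / 2))
      (fun x : ℝ => 6 * x ^ (α + 3) - 2 * x ^ (α + 1)) (uIcc 0 1) := by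
    intro x hx
    rw [uIcc_of_le zero_le_one] at hx
    change 4 * x ^ (α + 1) * ((3 * x ^ 2 - 1) / 2) = 6 * x ^ (α + 3) - 2 * x ^ (α + 1)
    rw [show α + 3 = α + 1 + (2 : ℕ) by push_cast; ring, rpow_add_natCast' hx.1 (by push_cast; linarith)]
    ring
  have h6 : IntervalIntegrable (fun x : ℝ => 6 * x ^ (α + 3)) volume 0 1 :=
    (intervalIntegral.intervalIntegrable_rpow' (by linarith)).const_mul 6
  have h2 : IntervalIntegrable (fun x : ℝ => 2 * x ^ (α + 1)) volume 0 1 :=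
    (intervalIntegral.intervalIntegrable_rpow' (by linarith)).const_mul 2
  rw [integral_congr heq, integral_sub h6 h2, intervalIntegral.integral_const_mul,
    intervalIntegral.integral_const_mul, integral_rpow (Or.inl (by linarith)),
    integral_rpow (Or.inl (by linarith)), zero_rpow (by linarith : (0:ℝ) < α + 3 + 1).ne',
    zero_rpow (by linarith : (0:ℝ) < α + 1 + 1).ne', one_rpow, one_rpow]
  have h1 : α + 3 + 1 ≠ 0 := by linarith
  have h1' : α + 1 + 1 ≠ 0 := by linarith
  have h1'' : α + 2 ≠ 0 := by linarith
  have h1''' : α + 4 ≠ 0 := by linarith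
  field_simp
  ring

/-- **No indicial root in the quadrupole sector**: `λ₂(α) = (4α+4)/((α+2)(α+4)) < 1` for every `-2 < α`
(`(α+2)(α+4) - (4α+4) = (α+1)² + 3 > 0`). Together with `t12_indicial_ell2`: no separable far-field
homogeneous solution `|v|^α Y₂`, `α > -1`, of the linearised hard-sphere equation. [folklore] -/
theorem t12_indicial_ell2_lt_one : ∀ α : ℝ, -2 < α → (4 * α + 4) / ((α + 2) * (α + 4)) < 1 := by
  intro α hα
  have hden : 0 < (α + 2) * (α + 4) := mul_pos (by linarith) (by linarith)
  rw [div_lt_one hden]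
  nlinarith [sq_nonneg (α + 1)]

/-- **`λ₂(1) = 8/15`** — the `ℓ = 2` entry of the resonance table at linear growth:
`4 ∫₀¹ ρ² P₂(ρ) dρ = 8/15` (`= sup_{ℓ ≥ 2} |λ_ℓ(1)| < 1`: one far-field step already contracts every
separable quadrupole profile of linear growth). [folklore] -/
theorem t12_indicial_ell2_one : ∫ x in (0:ℝ)..1, 4 * x ^ 2 * ((3 * x ^ 2 - 1) / 2) = 8 / 15 := by
  rw [integral_eq_sub_of_hasDerivAt (f := fun y : ℝ => 6 * y ^ 5 / 5 - 2 * y ^ 3 / 3)]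
  · norm_num
  · intro x _
    have h5 : HasDerivAt (fun y : ℝ => y ^ 5) (5 * x ^ 4) x := by simpa using hasDerivAt_pow 5 x
    have h3 : HasDerivAt (fun y : ℝ => y ^ 3) (3 * x ^ 2) x := by simpa using hasDerivAt_pow 3 x
    refine (((h5.const_mul 6).div_const 5).sub ((h3.const_mul 2).div_const 3)).congr_deriv ?_
    ring
  · exact (by fun_prop : Continuous fun x : ℝ => 4 * x ^ 2 * ((3 * x ^ 2 - 1) / 2)).intervalIntegrable 0 1

/-- **`λ₃(1) = 1/6`** — the `ℓ = 3` entry of the resonance table at linear growth: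
`4 ∫₀¹ ρ² P₃(ρ) dρ = 1/6`, `P₃(ρ) = (5ρ³ - 3ρ)/2`. [folklore] -/
theorem t12_indicial_ell3_one : ∫ x in (0:ℝ)..1, 4 * x ^ 2 * ((5 * x ^ 3 - 3 * x) / 2) = 1 / 6 := by
  rw [integral_eq_sub_of_hasDerivAt (f := fun y : ℝ => 10 * y ^ 6 / 6 - 6 * y ^ 4 / 4)]
  · norm_num
  · intro x _
    have h6 : HasDerivAt (fun y : ℝ => y ^ 6) (6 * x ^ 5) x := by simpa using hasDerivAt_pow 6 x
    have h4 : HasDerivAt (fun y : ℝ => y ^ 4) (4 * x ^ 3) x := by simpa using hasDerivAt_pow 4 x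
    refine (((h6.const_mul 10).div_const 6).sub ((h4.const_mul 6).div_const 4)).congr_deriv ?_
    ring
  · exact (by fun_prop : Continuous fun x : ℝ => 4 * x ^ 2 * ((5 * x ^ 3 - 3 * x) / 2)).intervalIntegrable 0 1

/-- **`λ₄(1) = 0`** — the `ℓ = 4` entry of the resonance table at linear growth:
`4 ∫₀¹ ρ² P₄(ρ) dρ = 0`, `P₄(ρ) = (35ρ⁴ - 30ρ² + 3)/8` (indeed `λ_ℓ(1) = 0` for every even `ℓ ≥ 4`: for even
`ℓ` the half-range moment is half the full-range one, `∫₀¹ ρ² P_ℓ = ½ ∫₋₁¹ ρ² P_ℓ = 0` as `deg ρ² = 2 < ℓ`). [folklore] -/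
theorem t12_indicial_ell4_one : ∫ x in (0:ℝ)..1, 4 * x ^ 2 * ((35 * x ^ 4 - 30 * x ^ 2 + 3) / 8) = 0 := by
  rw [integral_eq_sub_of_hasDerivAt (f := fun y : ℝ => 35 * y ^ 7 / 14 - 3 * y ^ 5 + y ^ 3 / 2)]
  · norm_num
  · intro x _
    have h7 : HasDerivAt (fun y : ℝ => y ^ 7) (7 * x ^ 6) x := by simpa using hasDerivAt_pow 7 x
    have h5 : HasDerivAt (fun y : ℝ => y ^ 5) (5 * x ^ 4) x := by simpa using hasDerivAt_pow 5 x
    have h3 : HasDerivAt (fun y : ℝ => y ^ 3) (3 * x ^ 2) x := by simpa using hasDerivAt_pow 3 x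
    refine ((((h7.const_mul 35).div_const 14).sub (h5.const_mul 3)).add (h3.div_const 2)).congr_deriv ?_
    ring
  · exact (by fun_prop : Continuous fun x : ℝ =>
      4 * x ^ 2 * ((35 * x ^ 4 - 30 * x ^ 2 + 3) / 8)).intervalIntegrable 0 1

end Summit.AtomisticToContinuum.HydrodynamicLimit.Theorems.ClampedCorrectorBirth

end
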